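import Mathlib
import Summits.AtomisticToContinuum.HydrodynamicLimit.Theorems.ImplosionDichotomyDenseExcursionSonicSlavingLoopCoeff
import Summits.AtomisticToContinuum.HydrodynamicLimit.Theorems.ImplosionDichotomyDenseExcursionSonicSlavingWedgeLocal

/-!
# The coefficient functions of the slaved gauge on the punctured sonic wedge: the derivative of the complex slaving coefficient,
# differentiability, and the pointwise package at a contour point
# (crux `DenseExcursion`, line `sonic-cavity-renewal` v7, brick (M4)-(P4′) for the registered stub `stub_sonicSlaving`)

Helper file (`--supports stmt-AtomisticToContinuum-12586`, line lead a2, stub-worker A (wave 3) for `stub_sonicSlaving`).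

With `Wc, Sc` holomorphic on the sonic wedge and the complex characteristic coefficients written out EXPLICITLY (same syntax as
`path_slaved_gauge` and the proposed loop clause of the worker report), this file proves, at a point `z` of the punctured wedge:
* `hasDerivAt_charRho` (registered helper): the complex slaving coefficient `ρ = b₊₋/Q`, `Q = (Λ − b₊₊) − k₁(Λ − b₋₋)`, `k₁ = c₊/c₋`, has
  complex derivative `ρ′ = (b₊₋′Q − b₊₋Q′)/Q²` with `Q′ = −b₊₊′ − k₁′(Λ − b₋₋) + k₁ b₋₋′`, `k₁′ = c₊′/c₋ − c₊c₋′/c₋²` (quotient rule) — the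
  hypothesis `hρ` of `path_slaved_gauge`;
* `differentiableAt_charCoeffs`: the Levinson coefficient `q`, the coupling `α = −b₋₊/c₋`, `ρ`, the forcing ingredient `ρ′`-expression and
  the phase speed `(Λ − b₋₋)/c₋` are complex-differentiable at `z` (continuity of the pulled-back coefficients along the contour);
* `contour_pointwise`: from the loop clause AT `z` (the sup bounds (L) and the tangent triple at `(z, τ)`), `‖τ‖ ≤ 1`, `c ≥ 0` and the
  rate range `Im Λ ≥ 1000`, `−1/4 ≤ Re Λ ≤ 3`: `Q ≠ 0`, `‖ρ‖ ≤ 400/(127 Im Λ)`, `0 ≤ Re((cτ)q − (cτ)αρ)`,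
  `‖(cτ)ρ′ + (cτ)αρ²‖ ≤ (25/4)/Im Λ · c‖τ‖`, `‖(cτ)α‖ ≤ (4/5) c‖τ‖` — the pointwise hypotheses of
  `Literature.Analysis.ODE.loop_slaving_estimate`, by the number-level lemmas of `…SonicSlavingLoopCoeff`.
No citation is load-bearing.
-/

noncomputable section

open Set Complex

namespace Summit.AtomisticToContinuum.HydrodynamicLimit.Theorems.SonicCavityRenewal

/-- First and second complex derivatives of a function holomorphic on the wedge, at a wedge point. [folklore] -/
theorem hasDerivAt_deriv_sonicWedge {f : ℂ → ℂ} (hf : DifferentiableOn ℂ f sonicWedge) {z : ℂ} (hz : z ∈ sonicWedge) :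
    HasDerivAt f (deriv f z) z ∧ HasDerivAt (deriv f) (deriv (deriv f) z) z :=
  ⟨(hf.differentiableAt (isOpen_sonicWedge.mem_nhds hz)).hasDerivAt,
    ((differentiableOn_deriv_sonicWedge hf).differentiableAt (isOpen_sonicWedge.mem_nhds hz)).hasDerivAt⟩

/-- **THE DERIVATIVE OF THE COMPLEX SLAVING COEFFICIENT** — registered helper `hasDerivAt_charRho` for `stub_sonicSlaving`:
`ρ = b₊₋/Q` has `ρ′ = (b₊₋′Q − b₊₋Q′)/Q²` at every wedge point where `c₋ Q ≠ 0`. [folklore] -/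
theorem hasDerivAt_charRho : ∀ (r : ℝ) (Wc Sc : ℂ → ℂ) (Λ z : ℂ), DifferentiableOn ℂ Wc sonicWedge → DifferentiableOn ℂ Sc sonicWedge → z ∈ sonicWedge → (Wc z - 1 - Sc z) ≠ 0 → ((Λ - (2 / 3 * deriv Wc z + 2 * Wc z - r + 2 * deriv Sc z + 4 * Sc z)) - (Wc z - 1 + Sc z) / (Wc z - 1 - Sc z) * (Λ - (2 / 3 * deriv Wc z + 2 * Wc z - r - 2 * deriv Sc z - 4 * Sc z))) ≠ 0 → HasDerivAt (fun z => ((deriv Wc z / 3 + deriv Sc z + 2 * Sc z) / ((Λ - (2 / 3 * deriv Wc z + 2 * Wc z - r + 2 * deriv Sc z + 4 * Sc z)) - (Wc z - 1 + Sc z) / (Wc z - 1 - Sc z) * (Λ - (2 / 3 * deriv Wc z + 2 * Wc z - r - 2 * deriv Sc z - 4 * Sc z))))) (((deriv (deriv Wc) z / 3 + deriv (deriv Sc) z + 2 * deriv Sc z) * ((Λ - (2 / 3 * deriv Wc z + 2 * Wc z - r + 2 * deriv Sc z + 4 * Sc z)) - (Wc z - 1 + Sc z) / (Wc z - 1 -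 Sc z) * (Λ - (2 / 3 * deriv Wc z + 2 * Wc z - r - 2 * deriv Sc z - 4 * Sc z))) - (deriv Wc z / 3 + deriv Sc z + 2 * Sc z) * (-(2 / 3 * deriv (deriv Wc) z + 2 * deriv Wc z + 2 * deriv (deriv Sc) z + 4 * deriv Sc z) - ((deriv Wc z + deriv Sc z) / (Wc z - 1 - Sc z) - (Wc z - 1 + Sc z) * (deriv Wc z - deriv Sc z) / (Wc z - 1 - Sc z) ^ 2) * (Λ - (2 / 3 * deriv Wc z + 2 * Wc z - r - 2 * deriv Sc z - 4 * Sc z)) + ((Wc z - 1 + Sc z) / (Wc z - 1 - Sc z)) * (2 / 3 * deriv (deriv Wc) z + 2 * deriv Wc z - 2 * deriv (deriv Sc) z - 4 * deriv Sc z))) / ((Λ - (2 / 3 * deriv Wc z + 2 * Wc z - r + 2 * deriv Sc z + 4 * Sc z)) - (Wc z - 1 + Sc z) / (Wc z - 1 - Sc z) * (Λ - (2 / 3 * deriv Wc z + 2 * Wc z - r - 2 * deriv Sc z - 4 * Sc z))) ^ 2) z := by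
  intro r Wc Sc Λ z hWc hSc hz hcm hQ
  obtain ⟨dW, ddW⟩ := hasDerivAt_deriv_sonicWedge hWc hz
  obtain ⟨dS, ddS⟩ := hasDerivAt_deriv_sonicWedge hSc hz
  have hN : HasDerivAt (fun z => (deriv Wc z / 3 + deriv Sc z + 2 * Sc z)) (deriv (deriv Wc) z / 3 + deriv (deriv Sc) z + 2 * deriv Sc z) z := ((ddW.div_const 3).add ddS).add (dS.const_mul 2)
  have hcp : HasDerivAt (fun z => (Wc z - 1 + Sc z)) (deriv Wc z + deriv Sc z) z := (dW.sub_const 1).add dS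
  have hcm' : HasDerivAt (fun z => (Wc z - 1 - Sc z)) (deriv Wc z - deriv Sc z) z := (dW.sub_const 1).sub dS
  have hk : HasDerivAt (fun z => ((Wc z - 1 + Sc z) / (Wc z - 1 - Sc z))) ((deriv Wc z + deriv Sc z) / (Wc z - 1 - Sc z) - (Wc z - 1 + Sc z) * (deriv Wc z - deriv Sc z) / (Wc z - 1 - Sc z) ^ 2) z := by
    refine (hcp.div hcm' hcm).congr_deriv ?_
    field_simp
  have hbpp : HasDerivAt (fun z => (2 / 3 * deriv Wc z + 2 * Wc z - r + 2 * deriv Sc z + 4 * Sc z)) (2 / 3 * deriv (deriv Wc) z + 2 * deriv Wc z + 2 * deriv (deriv Sc) z + 4 * deriv Sc z) z :=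
    ((((ddW.const_mul (2 / 3 : ℂ)).add (dW.const_mul 2)).sub_const (r : ℂ)).add (ddS.const_mul 2)).add (dS.const_mul 4)
  have hbmm : HasDerivAt (fun z => (2 / 3 * deriv Wc z + 2 * Wc z - r - 2 * deriv Sc z - 4 * Sc z)) (2 / 3 * deriv (deriv Wc) z + 2 * deriv Wc z - 2 * deriv (deriv Sc) z - 4 * deriv Sc z) z :=
    ((((ddW.const_mul (2 / 3 : ℂ)).add (dW.const_mul 2)).sub_const (r : ℂ)).sub (ddS.const_mul 2)).sub (dS.const_mul 4)
  have hL1 : HasDerivAt (fun z => Λ - (2 / 3 * deriv Wc z + 2 * Wc z - r + 2 * deriv Sc z + 4 * Sc z)) (0 - (2 / 3 * deriv (deriv Wc) z + 2 * deriv Wc z + 2 * deriv (deriv Sc) z + 4 * deriv Sc z)) z := (hasDerivAt_const z Λ).sub hbpp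
  have hL2 : HasDerivAt (fun z => Λ - (2 / 3 * deriv Wc z + 2 * Wc z - r - 2 * deriv Sc z - 4 * Sc z)) (0 - (2 / 3 * deriv (deriv Wc) z + 2 * deriv Wc z - 2 * deriv (deriv Sc) z - 4 * deriv Sc z)) z := (hasDerivAt_const z Λ).sub hbmm
  have hD : HasDerivAt (fun z => ((Λ - (2 / 3 * deriv Wc z + 2 * Wc z - r + 2 * deriv Sc z + 4 * Sc z)) - (Wc z - 1 + Sc z) / (Wc z - 1 - Sc z) * (Λ - (2 / 3 * deriv Wc z + 2 * Wc z - r - 2 * deriv Sc z - 4 * Sc z)))) (-(2 / 3 * deriv (deriv Wc) z + 2 * deriv Wc z + 2 * deriv (deriv Sc) z + 4 * deriv Sc z) - ((deriv Wc z + deriv Sc z) / (Wc z - 1 - Sc z) - (Wc z - 1 + Sc z) * (deriv Wc z - deriv Sc z) / (Wc z - 1 - Sc z) ^ 2) * (Λ - (2 / 3 * deriv Wc z + 2 * Wc z - r - 2 * deriv Sc z - 4 * Sc z)) + ((Wc z - 1 + Sc z) / (Wc z - 1 - Sc z)) * (2 / 3 * deriv (deriv Wc) z + 2 * deriv Wc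 z - 2 * deriv (deriv Sc) z - 4 * deriv Sc z)) z := by
    refine (hL1.sub (hk.mul hL2)).congr_deriv ?_
    ring
  exact hN.div hD hQ

/-- **Differentiability of the coefficient functions at a point of the punctured wedge** (`c₊ c₋ Q ≠ 0`): the Levinson coefficient
`q`, the coupling `α`, the slaving coefficient `ρ`, its derivative expression `ρ′`, and the phase speed `(Λ − b₋₋)/c₋`. [folklore] -/
theorem differentiableAt_charCoeffs {r : ℝ} {Wc Sc : ℂ → ℂ} {Λ z : ℂ} (hWc : DifferentiableOn ℂ Wc sonicWedge)
    (hSc : DifferentiableOn ℂ Sc sonicWedge) (hz : z ∈ sonicWedge) (hcp : (Wc z - 1 + Sc z) ≠ 0) (hcm : (Wc z - 1 - Sc z) ≠ 0) (hQ : ((Λ - (2 / 3 * deriv Wc z + 2 * Wc z - r + 2 * deriv Sc z + 4 * Sc z)) - (Wc z - 1 + Sc z) / (Wc z - 1 - Sc z) * (Λ - (2 / 3 * deriv Wc z + 2 * Wc z - r - 2 * deriv Sc z - 4 * Sc z))) ≠ 0) :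
    DifferentiableAt ℂ (fun z => ((Λ - (2 / 3 * deriv Wc z + 2 * Wc z - r + 2 * deriv Sc z + 4 * Sc z)) / (Wc z - 1 + Sc z) - (Λ - (2 / 3 * deriv Wc z + 2 * Wc z - r - 2 * deriv Sc z - 4 * Sc z)) / (Wc z - 1 - Sc z))) z ∧ DifferentiableAt ℂ (fun z => (-(deriv Wc z / 3 - deriv Sc z - 2 * Sc z) / (Wc z - 1 - Sc z))) z ∧ DifferentiableAt ℂ (fun z => ((deriv Wc z / 3 + deriv Sc z + 2 * Sc z) / ((Λ - (2 / 3 * deriv Wc z + 2 * Wc z - r + 2 * deriv Sc z + 4 * Sc z)) - (Wc z - 1 + Sc z) / (Wc z - 1 - Sc z) * (Λ - (2 / 3 * deriv Wc z + 2 * Wc z - r - 2 * deriv Sc z - 4 * Sc z))))) z ∧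
      DifferentiableAt ℂ (fun z => (((deriv (deriv Wc) z / 3 + deriv (deriv Sc) z + 2 * deriv Sc z) * ((Λ - (2 / 3 * deriv Wc z + 2 * Wc z - r + 2 * deriv Sc z + 4 * Sc z)) - (Wc z - 1 + Sc z) / (Wc z - 1 - Sc z) * (Λ - (2 / 3 * deriv Wc z + 2 * Wc z - r - 2 * deriv Sc z - 4 * Sc z))) - (deriv Wc z / 3 + deriv Sc z + 2 * Sc z) * (-(2 / 3 * deriv (deriv Wc) z + 2 * deriv Wc z + 2 * deriv (deriv Sc) z + 4 * deriv Sc z) - ((deriv Wc z + deriv Sc z) / (Wc z - 1 - Sc z) - (Wc z - 1 + Sc z) * (deriv Wc z - deriv Sc z) / (Wc z - 1 - Sc z) ^ 2) * (Λ - (2 / 3 * deriv Wc z + 2 * Wc z - r - 2 * deriv Sc z - 4 * Sc z)) + ((Wc z - 1 + Sc z) / (Wc z - 1 - Sc z)) * (2 / 3 * deriv (deriv Wc) z + 2 * deriv Wc z - 2 * deriv (deriv Sc) z - 4 * deriv Sc z))) / ((Λ - (2 / 3 * deriv Wc z + 2 * Wc z - r + 2 * deriv Sc z + 4 * Sc z))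 - (Wc z - 1 + Sc z) / (Wc z - 1 - Sc z) * (Λ - (2 / 3 * deriv Wc z + 2 * Wc z - r - 2 * deriv Sc z - 4 * Sc z))) ^ 2)) z ∧ DifferentiableAt ℂ (fun z => ((Λ - (2 / 3 * deriv Wc z + 2 * Wc z - r - 2 * deriv Sc z - 4 * Sc z)) / (Wc z - 1 - Sc z))) z := by
  have hn : sonicWedge ∈ nhds z := isOpen_sonicWedge.mem_nhds hz
  have dW : DifferentiableAt ℂ Wc z := hWc.differentiableAt hn
  have dS : DifferentiableAt ℂ Sc z := hSc.differentiableAt hn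
  have ddW : DifferentiableAt ℂ (deriv Wc) z := (differentiableOn_deriv_sonicWedge hWc).differentiableAt hn
  have ddS : DifferentiableAt ℂ (deriv Sc) z := (differentiableOn_deriv_sonicWedge hSc).differentiableAt hn
  have dddW : DifferentiableAt ℂ (deriv (deriv Wc)) z :=
    (differentiableOn_deriv_sonicWedge (differentiableOn_deriv_sonicWedge hWc)).differentiableAt hn
  have dddS : DifferentiableAt ℂ (deriv (deriv Sc)) z :=
    (differentiableOn_deriv_sonicWedge (differentiableOn_deriv_sonicWedge hSc)).differentiableAt hn
  have hQ2 : ((Λ - (2 / 3 * deriv Wc z + 2 * Wc z - r + 2 * deriv Sc z + 4 * Sc z)) - (Wc z - 1 + Sc z) / (Wc z - 1 - Sc z) * (Λ - (2 / 3 * deriv Wc z + 2 * Wc z - r - 2 * deriv Sc z - 4 * Sc z))) ^ 2 ≠ 0 := pow_ne_zero 2 hQ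
  have hcm2 : (Wc z - 1 - Sc z) ^ 2 ≠ 0 := pow_ne_zero 2 hcm
  refine ⟨?_, ?_, ?_, ?_, ?_⟩ <;> fun_prop (disch := assumption)


/-- **THE POINTWISE PACKAGE AT A CONTOUR POINT.** From the loop clause at `z` — the sup bounds (L) and the tangent triple at `(z, τ)` —
`‖τ‖ ≤ 1`, `c ≥ 0` and the rate range: `Q ≠ 0`, `‖ρ‖ ≤ 400/(127 Im Λ)`, the exponent `Re((cτ)q − (cτ)αρ) ≥ 0`, the forcing
`‖(cτ)ρ′ + (cτ)αρ²‖ ≤ (25/4)/Im Λ·(c‖τ‖)`, and `‖(cτ)α‖ ≤ (4/5)(c‖τ‖)`. [folklore] -/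
theorem contour_pointwise {r : ℝ} {Wc Sc : ℂ → ℂ} {Λ z τ : ℂ} {c : ℝ} (hL : (‖(deriv Wc z / 3 - deriv Sc z - 2 * Sc z) / (Wc z - 1 - Sc z)‖ ≤ 4 / 5 ∧ ‖(deriv Wc z / 3 + deriv Sc z + 2 * Sc z)‖ ≤ 2 ∧ ‖(deriv (deriv Wc) z / 3 + deriv (deriv Sc) z + 2 * deriv Sc z)‖ ≤ 2 ∧ ‖((Wc z - 1 + Sc z) / (Wc z - 1 - Sc z))‖ ≤ 9 / 25 ∧ ‖((deriv Wc z + deriv Sc z) / (Wc z - 1 - Sc z) - (Wc z - 1 + Sc z) * (deriv Wc z - deriv Sc z) / (Wc z - 1 - Sc z) ^ 2)‖ ≤ 3 / 5 ∧ ‖(2 / 3 * deriv Wc z + 2 * Wc z - r + 2 * deriv Sc z + 4 * Sc z)‖ ≤ 3 ∧ ‖(2 / 3 * deriv Wc z + 2 * Wc z - r - 2 * deriv Sc z - 4 * Sc z)‖ ≤ 5 ∧ ‖(2 / 3 * deriv (deriv Wc) z + 2 * deriv Wc z + 2 * deriv (deriv Sc) z + 4 * deriv Sc z)‖ ≤ 4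 ∧ ‖(2 / 3 * deriv (deriv Wc) z + 2 * deriv Wc z - 2 * deriv (deriv Sc) z - 4 * deriv Sc z)‖ ≤ 4)) (hgood : (0 ≤ (-((τ) * (1 / (Wc z - 1 + Sc z) - 1 / (Wc z - 1 - Sc z))).im) ∧ 1 ≤ 1000 * (-((τ) * (1 / (Wc z - 1 + Sc z) - 1 / (Wc z - 1 - Sc z))).im) - (((τ) * (1 / (Wc z - 1 + Sc z) - 1 / (Wc z - 1 - Sc z))).re) / 4 + ((-((2 / 3 * deriv Wc z + 2 * Wc z - r + 2 * deriv Sc z + 4 * Sc z) * (τ) / (Wc z - 1 + Sc z)) + (2 / 3 * deriv Wc z + 2 * Wc z - r - 2 * deriv Sc z - 4 * Sc z) * (τ) / (Wc z - 1 - Sc z)).re) ∧ 1 ≤ 1000 * (-((τ) * (1 / (Wc z - 1 + Sc z) - 1 / (Wc z - 1 - Sc z))).im) + 3 * (((τ) * (1 / (Wc z - 1 + Sc z) - 1 / (Wc z - 1 - Sc z))).re) + ((-((2 / 3 * deriv Wc z + 2 * Wc z - r + 2 * deriv Sc z + 4 * Sc z) * (τ) / (Wc z - 1 + Sc z)) +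 (2 / 3 * deriv Wc z + 2 * Wc z - r - 2 * deriv Sc z - 4 * Sc z) * (τ) / (Wc z - 1 - Sc z)).re))) (hτ : ‖τ‖ ≤ 1) (hc : 0 ≤ c)
    (hI : 1000 ≤ Λ.im) (hR1 : -(1 / 4 : ℝ) ≤ Λ.re) (hR2 : Λ.re ≤ 3) :
    ((Λ - (2 / 3 * deriv Wc z + 2 * Wc z - r + 2 * deriv Sc z + 4 * Sc z)) - (Wc z - 1 + Sc z) / (Wc z - 1 - Sc z) * (Λ - (2 / 3 * deriv Wc z + 2 * Wc z - r - 2 * deriv Sc z - 4 * Sc z))) ≠ 0 ∧ ‖((deriv Wc z / 3 + deriv Sc z + 2 * Sc z) / ((Λ - (2 / 3 * deriv Wc z + 2 * Wc z - r + 2 * deriv Sc z + 4 * Sc z)) - (Wc z - 1 + Sc z) / (Wc z - 1 - Sc z) * (Λ - (2 / 3 * deriv Wc z + 2 * Wc z - r - 2 * deriv Sc z - 4 * Sc z))))‖ ≤ 400 / (127 * Λ.im) ∧ 0 ≤ ((c : ℂ) * τ * ((Λ - (2 / 3 * deriv Wc z + 2 * Wc z - r + 2 * deriv Sc z + 4 *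 Sc z)) / (Wc z - 1 + Sc z) - (Λ - (2 / 3 * deriv Wc z + 2 * Wc z - r - 2 * deriv Sc z - 4 * Sc z)) / (Wc z - 1 - Sc z)) - (c : ℂ) * τ * (-(deriv Wc z / 3 - deriv Sc z - 2 * Sc z) / (Wc z - 1 - Sc z)) * ((deriv Wc z / 3 + deriv Sc z + 2 * Sc z) / ((Λ - (2 / 3 * deriv Wc z + 2 * Wc z - r + 2 * deriv Sc z + 4 * Sc z)) - (Wc z - 1 + Sc z) / (Wc z - 1 - Sc z) * (Λ - (2 / 3 * deriv Wc z + 2 * Wc z - r - 2 * deriv Sc z - 4 * Sc z))))).re ∧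
      ‖(c : ℂ) * τ * (((deriv (deriv Wc) z / 3 + deriv (deriv Sc) z + 2 * deriv Sc z) * ((Λ - (2 / 3 * deriv Wc z + 2 * Wc z - r + 2 * deriv Sc z + 4 * Sc z)) - (Wc z - 1 + Sc z) / (Wc z - 1 - Sc z) * (Λ - (2 / 3 * deriv Wc z + 2 * Wc z - r - 2 * deriv Sc z - 4 * Sc z))) - (deriv Wc z / 3 + deriv Sc z + 2 * Sc z) * (-(2 / 3 * deriv (deriv Wc) z + 2 * deriv Wc z + 2 * deriv (deriv Sc) z + 4 * deriv Sc z) - ((deriv Wc z + deriv Sc z) / (Wc z - 1 - Sc z) - (Wc z - 1 + Sc z) * (deriv Wc z - deriv Sc z) / (Wc z - 1 - Sc z) ^ 2) * (Λ - (2 / 3 * deriv Wc z + 2 * Wc z - r - 2 * deriv Sc z - 4 * Sc z)) + ((Wc z - 1 + Sc z) / (Wc z - 1 - Sc z)) * (2 / 3 * deriv (deriv Wc) z + 2 * deriv Wc z - 2 * deriv (deriv Sc) z - 4 * deriv Sc z))) / ((Λ - (2 / 3 * deriv Wc z + 2 * Wc z - r + 2 * deriv Sc z + 4 * Sc z)) -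 (Wc z - 1 + Sc z) / (Wc z - 1 - Sc z) * (Λ - (2 / 3 * deriv Wc z + 2 * Wc z - r - 2 * deriv Sc z - 4 * Sc z))) ^ 2) + (c : ℂ) * τ * (-(deriv Wc z / 3 - deriv Sc z - 2 * Sc z) / (Wc z - 1 - Sc z)) * ((deriv Wc z / 3 + deriv Sc z + 2 * Sc z) / ((Λ - (2 / 3 * deriv Wc z + 2 * Wc z - r + 2 * deriv Sc z + 4 * Sc z)) - (Wc z - 1 + Sc z) / (Wc z - 1 - Sc z) * (Λ - (2 / 3 * deriv Wc z + 2 * Wc z - r - 2 * deriv Sc z - 4 * Sc z)))) ^ 2‖ ≤ 25 / 4 / Λ.im * (c * ‖τ‖) ∧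
      ‖(c : ℂ) * τ * (-(deriv Wc z / 3 - deriv Sc z - 2 * Sc z) / (Wc z - 1 - Sc z))‖ ≤ 4 / 5 * (c * ‖τ‖) := by
  obtain ⟨hα0, hbpm, hbpm1, hk1, hk1p, hbpp, hbmm, hbpp1, hbmm1⟩ := hL
  have hα : ‖(-(deriv Wc z / 3 - deriv Sc z - 2 * Sc z) / (Wc z - 1 - Sc z))‖ ≤ 4 / 5 := by rw [neg_div, norm_neg]; exact hα0
  obtain ⟨hQne, hρ⟩ := norm_slaving_le (Λ := Λ) (k₁ := ((Wc z - 1 + Sc z) / (Wc z - 1 - Sc z))) (bpp := (2 / 3 * deriv Wc z + 2 * Wc z - r + 2 * deriv Sc z + 4 * Sc z)) (bmm := (2 / 3 * deriv Wc z + 2 * Wc z - r - 2 * deriv Sc z - 4 * Sc z)) (bpm := (deriv Wc z / 3 + deriv Sc z + 2 * Sc z)) hk1 hbpp hbmm hbpm hI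
  refine ⟨hQne, hρ, ?_, ?_, norm_pathAlpha_le hc hα⟩
  · exact re_transport_nonneg (cp := (Wc z - 1 + Sc z)) (cm := (Wc z - 1 - Sc z)) (bpp := (2 / 3 * deriv Wc z + 2 * Wc z - r + 2 * deriv Sc z + 4 * Sc z)) (bmm := (2 / 3 * deriv Wc z + 2 * Wc z - r - 2 * deriv Sc z - 4 * Sc z)) (α := (-(deriv Wc z / 3 - deriv Sc z - 2 * Sc z) / (Wc z - 1 - Sc z))) (ρ := ((deriv Wc z / 3 + deriv Sc z + 2 * Sc z) / ((Λ - (2 / 3 * deriv Wc z + 2 * Wc z - r + 2 * deriv Sc z + 4 * Sc z)) - (Wc z - 1 + Sc z) / (Wc z - 1 - Sc z) * (Λ - (2 / 3 * deriv Wc z + 2 * Wc z - r - 2 * deriv Sc z - 4 * Sc z))))) hc hτ hgood.1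
      hgood.2.1 hgood.2.2 hI hR1 hR2 hα hρ
  · have hQge := norm_charQ_ge (Λ := Λ) (k₁ := ((Wc z - 1 + Sc z) / (Wc z - 1 - Sc z))) (bpp := (2 / 3 * deriv Wc z + 2 * Wc z - r + 2 * deriv Sc z + 4 * Sc z)) (bmm := (2 / 3 * deriv Wc z + 2 * Wc z - r - 2 * deriv Sc z - 4 * Sc z)) hk1 hbpp hbmm hI
    have hQ1 := norm_charQderiv_le (Λ := Λ) (k₁ := ((Wc z - 1 + Sc z) / (Wc z - 1 - Sc z))) (k₁' := ((deriv Wc z + deriv Sc z) / (Wc z - 1 - Sc z) - (Wc z - 1 + Sc z) * (deriv Wc z - deriv Sc z) / (Wc z - 1 - Sc z) ^ 2)) (bmm := (2 / 3 * deriv Wc z + 2 * Wc z - r - 2 * deriv Sc z - 4 * Sc z)) (bpp1 := (2 / 3 * deriv (deriv Wc) z + 2 * deriv Wc z + 2 * deriv (deriv Sc) z + 4 * deriv Sc z)) (bmm1 := (2 / 3 * deriv (deriv Wc) z + 2 * deriv Wc z - 2 * deriv (deriv Sc) z - 4 * deriv Sc z)) hk1 hk1p hbmm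
      hbpp1 hbmm1 hI hR1 hR2
    have hF := norm_slavedForcing_le (Q := ((Λ - (2 / 3 * deriv Wc z + 2 * Wc z - r + 2 * deriv Sc z + 4 * Sc z)) - (Wc z - 1 + Sc z) / (Wc z - 1 - Sc z) * (Λ - (2 / 3 * deriv Wc z + 2 * Wc z - r - 2 * deriv Sc z - 4 * Sc z)))) (Q1 := (-(2 / 3 * deriv (deriv Wc) z + 2 * deriv Wc z + 2 * deriv (deriv Sc) z + 4 * deriv Sc z) - ((deriv Wc z + deriv Sc z) / (Wc z - 1 - Sc z) - (Wc z - 1 + Sc z) * (deriv Wc z - deriv Sc z) / (Wc z - 1 - Sc z) ^ 2) * (Λ - (2 / 3 * deriv Wc z + 2 * Wc z - r - 2 * deriv Sc z - 4 * Sc z)) + ((Wc z - 1 + Sc z) / (Wc z - 1 - Sc z)) * (2 / 3 * deriv (deriv Wc) z + 2 * deriv Wc z - 2 * deriv (deriv Sc) z - 4 * deriv Sc z))) (bpm := (deriv Wc z / 3 + deriv Sc z + 2 * Sc z)) (bpm1 := (deriv (deriv Wc) z / 3 + deriv (deriv Sc) z + 2 * deriv Sc z)) (α := (-(deriv Wc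 z / 3 - deriv Sc z - 2 * Sc z) / (Wc z - 1 - Sc z))) hQge hQ1 hbpm hbpm1 hα hI
    have e : (c : ℂ) * τ * (((deriv (deriv Wc) z / 3 + deriv (deriv Sc) z + 2 * deriv Sc z) * ((Λ - (2 / 3 * deriv Wc z + 2 * Wc z - r + 2 * deriv Sc z + 4 * Sc z)) - (Wc z - 1 + Sc z) / (Wc z - 1 - Sc z) * (Λ - (2 / 3 * deriv Wc z + 2 * Wc z - r - 2 * deriv Sc z - 4 * Sc z))) - (deriv Wc z / 3 + deriv Sc z + 2 * Sc z) * (-(2 / 3 * deriv (deriv Wc) z + 2 * deriv Wc z + 2 * deriv (deriv Sc) z + 4 * deriv Sc z) - ((deriv Wc z + deriv Sc z) / (Wc z - 1 - Sc z) - (Wc z - 1 + Sc z) * (deriv Wc z - deriv Sc z) / (Wc z - 1 - Sc z) ^ 2) * (Λ - (2 / 3 * deriv Wc z + 2 * Wc z - r - 2 * deriv Sc z - 4 * Sc z)) + ((Wc z - 1 + Sc z) / (Wc z - 1 - Sc z)) * (2 / 3 * deriv (deriv Wc) z + 2 * deriv Wc z - 2 * deriv (deriv Sc) z - 4 * deriv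 Sc z))) / ((Λ - (2 / 3 * deriv Wc z + 2 * Wc z - r + 2 * deriv Sc z + 4 * Sc z)) - (Wc z - 1 + Sc z) / (Wc z - 1 - Sc z) * (Λ - (2 / 3 * deriv Wc z + 2 * Wc z - r - 2 * deriv Sc z - 4 * Sc z))) ^ 2) + (c : ℂ) * τ * (-(deriv Wc z / 3 - deriv Sc z - 2 * Sc z) / (Wc z - 1 - Sc z)) * ((deriv Wc z / 3 + deriv Sc z + 2 * Sc z) / ((Λ - (2 / 3 * deriv Wc z + 2 * Wc z - r + 2 * deriv Sc z + 4 * Sc z)) - (Wc z - 1 + Sc z) / (Wc z - 1 - Sc z) * (Λ - (2 / 3 * deriv Wc z + 2 * Wc z - r - 2 * deriv Sc z - 4 * Sc z)))) ^ 2 = ((c : ℂ) * τ) * ((((deriv (deriv Wc) z / 3 + deriv (deriv Sc) z + 2 * deriv Sc z) * ((Λ - (2 / 3 * deriv Wc z + 2 * Wc z - r + 2 * deriv Sc z + 4 * Sc z)) - (Wc z - 1 + Sc z) / (Wc z - 1 - Sc z) * (Λ - (2 / 3 * deriv Wc z + 2 * Wc z - r - 2 * deriv Sc z - 4 * Sc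 z))) - (deriv Wc z / 3 + deriv Sc z + 2 * Sc z) * (-(2 / 3 * deriv (deriv Wc) z + 2 * deriv Wc z + 2 * deriv (deriv Sc) z + 4 * deriv Sc z) - ((deriv Wc z + deriv Sc z) / (Wc z - 1 - Sc z) - (Wc z - 1 + Sc z) * (deriv Wc z - deriv Sc z) / (Wc z - 1 - Sc z) ^ 2) * (Λ - (2 / 3 * deriv Wc z + 2 * Wc z - r - 2 * deriv Sc z - 4 * Sc z)) + ((Wc z - 1 + Sc z) / (Wc z - 1 - Sc z)) * (2 / 3 * deriv (deriv Wc) z + 2 * deriv Wc z - 2 * deriv (deriv Sc) z - 4 * deriv Sc z))) / ((Λ - (2 / 3 * deriv Wc z + 2 * Wc z - r + 2 * deriv Sc z + 4 * Sc z)) - (Wc z - 1 + Sc z) / (Wc z - 1 - Sc z) * (Λ - (2 / 3 * deriv Wc z + 2 * Wc z - r - 2 * deriv Sc z - 4 * Sc z))) ^ 2) + (-(deriv Wc z / 3 - deriv Sc z - 2 * Sc z) / (Wc z - 1 - Sc z)) * ((deriv Wc z / 3 + deriv Sc z + 2 * Sc z) / ((Λ - (2 / 3 * deriv Wc z + 2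 * Wc z - r + 2 * deriv Sc z + 4 * Sc z)) - (Wc z - 1 + Sc z) / (Wc z - 1 - Sc z) * (Λ - (2 / 3 * deriv Wc z + 2 * Wc z - r - 2 * deriv Sc z - 4 * Sc z)))) ^ 2) := by ring
    rw [e, norm_mul, norm_mul, Complex.norm_real, Real.norm_eq_abs, abs_of_nonneg hc]
    calc c * ‖τ‖ * ‖(((deriv (deriv Wc) z / 3 + deriv (deriv Sc) z + 2 * deriv Sc z) * ((Λ - (2 / 3 * deriv Wc z + 2 * Wc z - r + 2 * deriv Sc z + 4 * Sc z)) - (Wc z - 1 + Sc z) / (Wc z - 1 - Sc z) * (Λ - (2 / 3 * deriv Wc z + 2 * Wc z - r - 2 * deriv Sc z - 4 * Sc z))) - (deriv Wc z / 3 + deriv Sc z + 2 * Sc z) * (-(2 / 3 * deriv (deriv Wc) z + 2 * deriv Wc z + 2 * deriv (deriv Sc) z + 4 * deriv Sc z) - ((deriv Wc z + deriv Sc z) / (Wc z - 1 - Sc z) - (Wc z - 1 + Sc z) * (deriv Wc z - deriv Sc z) / (Wc z - 1 - Sc z) ^ 2) * (Λ - (2 / 3 * deriv Wc z + 2 * Wc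 z - r - 2 * deriv Sc z - 4 * Sc z)) + ((Wc z - 1 + Sc z) / (Wc z - 1 - Sc z)) * (2 / 3 * deriv (deriv Wc) z + 2 * deriv Wc z - 2 * deriv (deriv Sc) z - 4 * deriv Sc z))) / ((Λ - (2 / 3 * deriv Wc z + 2 * Wc z - r + 2 * deriv Sc z + 4 * Sc z)) - (Wc z - 1 + Sc z) / (Wc z - 1 - Sc z) * (Λ - (2 / 3 * deriv Wc z + 2 * Wc z - r - 2 * deriv Sc z - 4 * Sc z))) ^ 2) + (-(deriv Wc z / 3 - deriv Sc z - 2 * Sc z) / (Wc z - 1 - Sc z)) * ((deriv Wc z / 3 + deriv Sc z + 2 * Sc z) / ((Λ - (2 / 3 * deriv Wc z + 2 * Wc z - r + 2 * deriv Sc z + 4 * Sc z)) - (Wc z - 1 + Sc z) / (Wc z - 1 - Sc z) * (Λ - (2 / 3 * deriv Wc z + 2 * Wc z - r - 2 * deriv Sc z - 4 * Sc z)))) ^ 2‖ ≤ c * ‖τ‖ * (25 / 4 / Λ.im) := mul_le_mul_of_nonneg_left hF (by positivity)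
      _ = 25 / 4 / Λ.im * (c * ‖τ‖) := by ring


/-- **THE STEEPNESS ON THE FIRST LEG**: at a point of the vertical leg (clause (V): `Re h ≥ 8/5`, `|Im h| ≤ 2/5`,
`|Im(b₊₊/c₊ − b₋₋/c₋)| ≤ 2/5`) with the downward tangent `τ = −η_m i`, `η_m = 189/2000`, and the sup bounds (L):
`1598·(c η_m) ≤ Re((cτ)q − (cτ)αρ)` — hypothesis `hv` of `loop_slaving_estimate` with `λ = 1598`, `v = ‖y′‖ = c η_m`. [folklore] -/
theorem contour_pointwise_vertical {r : ℝ} {Wc Sc : ℂ → ℂ} {Λ z : ℂ} {c : ℝ} (hL : (‖(deriv Wc z / 3 - deriv Sc z - 2 * Sc z) / (Wc z - 1 - Sc z)‖ ≤ 4 / 5 ∧ ‖(deriv Wc z / 3 + deriv Sc z + 2 * Sc z)‖ ≤ 2 ∧ ‖(deriv (deriv Wc) z / 3 + deriv (deriv Sc) z + 2 * deriv Sc z)‖ ≤ 2 ∧ ‖((Wc z - 1 + Sc z) / (Wc z - 1 - Sc z))‖ ≤ 9 / 25 ∧ ‖((deriv Wc z + deriv Sc z) / (Wc z - 1 - Sc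 z) - (Wc z - 1 + Sc z) * (deriv Wc z - deriv Sc z) / (Wc z - 1 - Sc z) ^ 2)‖ ≤ 3 / 5 ∧ ‖(2 / 3 * deriv Wc z + 2 * Wc z - r + 2 * deriv Sc z + 4 * Sc z)‖ ≤ 3 ∧ ‖(2 / 3 * deriv Wc z + 2 * Wc z - r - 2 * deriv Sc z - 4 * Sc z)‖ ≤ 5 ∧ ‖(2 / 3 * deriv (deriv Wc) z + 2 * deriv Wc z + 2 * deriv (deriv Sc) z + 4 * deriv Sc z)‖ ≤ 4 ∧ ‖(2 / 3 * deriv (deriv Wc) z + 2 * deriv Wc z - 2 * deriv (deriv Sc) z - 4 * deriv Sc z)‖ ≤ 4))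
    (hV1 : 8 / 5 ≤ ((1 / (Wc z - 1 + Sc z) - 1 / (Wc z - 1 - Sc z))).re) (hV2 : |((1 / (Wc z - 1 + Sc z) - 1 / (Wc z - 1 - Sc z))).im| ≤ 2 / 5) (hV3 : |((2 / 3 * deriv Wc z + 2 * Wc z - r + 2 * deriv Sc z + 4 * Sc z) / (Wc z - 1 + Sc z) - (2 / 3 * deriv Wc z + 2 * Wc z - r - 2 * deriv Sc z - 4 * Sc z) / (Wc z - 1 - Sc z)).im| ≤ 2 / 5) (hc : 0 ≤ c)
    (hI : 1000 ≤ Λ.im) (hR1 : -(1 / 4 : ℝ) ≤ Λ.re) (hR2 : Λ.re ≤ 3) :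
    1598 * (c * (189 / 2000)) ≤ ((c : ℂ) * (-((189 / 2000 : ℝ) : ℂ) * I) * ((Λ - (2 / 3 * deriv Wc z + 2 * Wc z - r + 2 * deriv Sc z + 4 * Sc z)) / (Wc z - 1 + Sc z) - (Λ - (2 / 3 * deriv Wc z + 2 * Wc z - r - 2 * deriv Sc z - 4 * Sc z)) / (Wc z - 1 - Sc z)) -
      (c : ℂ) * (-((189 / 2000 : ℝ) : ℂ) * I) * (-(deriv Wc z / 3 - deriv Sc z - 2 * Sc z) / (Wc z - 1 - Sc z)) * ((deriv Wc z / 3 + deriv Sc z + 2 * Sc z) / ((Λ - (2 / 3 * deriv Wc z + 2 * Wc z - r + 2 * deriv Sc z + 4 * Sc z)) - (Wc z - 1 + Sc z) / (Wc z - 1 - Sc z) * (Λ - (2 / 3 * deriv Wc z + 2 * Wc z - r - 2 * deriv Sc z - 4 * Sc z))))).re := by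
  obtain ⟨hα0, hbpm, hbpm1, hk1, hk1p, hbpp, hbmm, hbpp1, hbmm1⟩ := hL
  have hα : ‖(-(deriv Wc z / 3 - deriv Sc z - 2 * Sc z) / (Wc z - 1 - Sc z))‖ ≤ 4 / 5 := by rw [neg_div, norm_neg]; exact hα0
  obtain ⟨hQne, hρ⟩ := norm_slaving_le (Λ := Λ) (k₁ := ((Wc z - 1 + Sc z) / (Wc z - 1 - Sc z))) (bpp := (2 / 3 * deriv Wc z + 2 * Wc z - r + 2 * deriv Sc z + 4 * Sc z)) (bmm := (2 / 3 * deriv Wc z + 2 * Wc z - r - 2 * deriv Sc z - 4 * Sc z)) (bpm := (deriv Wc z / 3 + deriv Sc z + 2 * Sc z)) hk1 hbpp hbmm hbpm hI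
  exact re_transport_ge_vertical (cp := (Wc z - 1 + Sc z)) (cm := (Wc z - 1 - Sc z)) (bpp := (2 / 3 * deriv Wc z + 2 * Wc z - r + 2 * deriv Sc z + 4 * Sc z)) (bmm := (2 / 3 * deriv Wc z + 2 * Wc z - r - 2 * deriv Sc z - 4 * Sc z)) (α := (-(deriv Wc z / 3 - deriv Sc z - 2 * Sc z) / (Wc z - 1 - Sc z))) (ρ := ((deriv Wc z / 3 + deriv Sc z + 2 * Sc z) / ((Λ - (2 / 3 * deriv Wc z + 2 * Wc z - r + 2 * deriv Sc z + 4 * Sc z)) - (Wc z - 1 + Sc z) / (Wc z - 1 - Sc z) * (Λ - (2 / 3 * deriv Wc z + 2 * Wc z - r - 2 * deriv Sc z - 4 * Sc z))))) (η := 189 / 2000)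
    hc (by norm_num) hV1 hV2 hV3 hI hR1 hR2 hα hρ

end Summit.AtomisticToContinuum.HydrodynamicLimit.Theorems.SonicCavityRenewal

end
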